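import Summits.QuantumFields.BalabanUV.Beta.GAN24.TaylorRowLamTopTable
import Summits.QuantumFields.BalabanUV.Beta.GAN24.StencilSlotE3HLeg
import Summits.QuantumFields.BalabanUV.Beta.GAN24.StencilSlotE3PhiLeg
import Summits.QuantumFields.BalabanUV.Beta.GAN24.TaylorSandwich
import Summits.QuantumFields.BalabanUV.Beta.GAN24.E3UnitSplitLevels

/-!
# `BalabanUV.Beta.GAN24.TaylorRowLamTop` — binder row G-an2-4 / (CONV-C), S-slot road «S3-Taylor», PART III SHAPE ROW **S3-Lt** (ROW-Λt, the TOP Λ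
# increment; holder b2b-balaban-gan24-formalise-leaf-10, CLAIMS l.4646): `∃ CtL δ, 0 < δ ∧ ∀ n, LocStencil (N^{2(d+1)}·e3OfS N ((cΛ·M^{2d+4}) • lagrInc d Lc M N)) CtL δ`
# at `d = 3` (`N = Lc^{n+2}`, `M = Lc^{n+1}`), with `CtL` FREE OF THE MEMBER `n` — the hypothesis `hLt` of the owner's END `StencilSlotE3OfPieces.e3Shape_of_pieces`
# (statement copied from staged 2cc3c5eb8d83de1a ∕ typer stub `Formal/Statements/S3_PieceShapes.ShapeLt`, `d := 3`), ∃-packaged per carver l.4876 (3).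

NOT IN PRINT; OUR PROOF ATTEMPT (unit b2b-balaban-gan24-formalise-leaf-10, gen 12).  HONEST FRAMING (cell contract, verbatim): «discharging `BetaPertH` makes
Bałaban's UV stability UNCONDITIONAL — a real constructive-QFT result; it is NOT the continuum limit and NOT the Clay problem.»  HONEST DEPENDENCY (verbatim):
«continuum YM on T⁴ ⇐ BetaPertH ∧ nine spine estimates (0/9 proved); BetaPertH ⇐ (D1) ∧ (D4) ∧ CAP+tail; G-an2-4 gates asym, D1 and NE2/3/4.»  [folklore]
assembly over TREE modules BY NAME: leaf-01's unit split `E3UnitSplitLevels.e3LamTop_unit_split`, leaf-10's `TaylorLamBracket.vertex_lagrInc_top` (the Λ vertex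
insertion at the top level: the fine vertex sum, the multiplier response and the gauge term are gone — `ResolventComposition.wM_eq_zero` underneath), the owner's
one-channel engine `TaylorSandwich.sandwich_bound` VERBATIM (no new sandwich lemma: the coarse superposition is re-indexed onto the lattice points `u = N•Y` by
`InterLevelTransport.onLat`, as leaf-08's ROW-Λ0), the (N1) legs `StencilSlotE3HLeg.legs_three` (leaf-16's `FineReadoutDecay` inside) and the K-slot leg
`StencilSlotE3PhiLeg.phiLeg_three` (road P1 inside), leaf-11's L2 `TaylorMassLam.abs_avgLift_hessFF_le` ∕ `avgLift_hessFF_ne_zero`.  Part 1 = `GAN24/TaylorRowLamTopTable` (the synthetic table `tabT`, its supports and mass, `vertex_sandwich_form`); here FOUR plumbing `def`s (the row's `n`-free radii and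
constants `rowR`, `rowK`, `rowCm`, `rowE`; assert nothing), 0 cite, 0 `def … : Prop`.  The ROW is ONE of 12; it discharges NOTHING of (hS, hSall) by itself;
«E3Shape»∕«E3SupRate» stay OPEN until all 12 rows and the three ENDs are tree theorems.  NOT summit progress.

THE COUNT (d = 3, member `n`, `N = Lc^{n+2}`, `M = Lc^{n+1}`): prefactor `(cΛ∕Lc⁴)·N^{3−2}·M^{3+3}` (unit split) × vertex leg `N^{3+2}·wΦ_N = O(N^{−3})` (K-slot:
`|N^8 wΦ_N| ≤ C_Φ`) × per-`y` table mass `≤ Cm·M^{−4}` (sup `2ℓ²∕M^8` × `w`-support `(4R″M+1)^4` × `(2K+1)^4` lattice points `u = N•Y`) × `sandwich_bound`'s `N`-free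
legs and block sum ⇒ `|piece| ≤ [(|cΛ|∕Lc⁴)·4·C₁²·C_Φ·Cm·E₁·E₂·Zl₄(κ∕2)]·(M∕N)²·e^{−(κ∕2)(|x′−u′|₁+|z′−u′|₁)}`, `(M∕N)² = Lc⁻² ≤ 1`: **CtL n-FREE**, rate `κ∕2` with
`κ = min(κ_{N1}, δ_{N3})`.  (The block sum does not see that `y` sits within `R″M ≪ N` of the block centre, which costs `(M∕N)^{d+1}`; n-freeness is all the row asks.)
-/

noncomputable section

open Finset
open scoped BigOperators
open Literature.MathematicalPhysics.QuantumFieldTheory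
open Literature.MathematicalPhysics.QuantumFieldTheory.LatticeForm (quo)
open Literature.Probability.LatticeModels (Torus.proj)
open Literature.MathematicalPhysics.QuantumFieldTheory.Balaban1983to89
open Literature.MathematicalPhysics.QuantumFieldTheory.Balaban1983to89.Beta
open B12Sec2to5 (l1 l1_nonneg)
open ExpKernelCalculus (MKer Zl Zl_pos l1_sub_symm)
open AffineAveraging (Site)
open OneStepResolventKernel (Fib KInv LocStencil KInv_inr_inr_coarse quo_zsmul bound_mono)
open KernelSpecInstance (wH wΦ)
open KKTFluctuationKernel (GamΦ)
open BalabanCompositeJets (lagrInc)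
open AveragingHessianKernels (ell)
open Summit.QuantumFields.BalabanUV.Beta.GAN24.E3UnitSplit (e3OfS e3OfS_inl_inr e3OfS_inr e3LamTop_unit_split)
open Summit.QuantumFields.BalabanUV.Beta.GAN24.TaylorSandwich (sandwich_bound)
open Summit.QuantumFields.BalabanUV.Beta.GAN24.StencilSlotE3HLeg (legs_three)
open Summit.QuantumFields.BalabanUV.Beta.GAN24.StencilSlotE3PhiLeg (phiLeg_three)
open Summit.QuantumFields.BalabanUV.Beta.GAN24.TaylorRowLamTopTable (tabT suppU suppW vertex_sandwich_form mem_suppW_of_ne_zero mem_suppU_of_ne_zero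
  l1_sub_le_of_mem_suppW l1_sub_le_of_mem_suppU mass_tabT_le)

namespace Summit.QuantumFields.BalabanUV.Beta.GAN24.TaylorRowLamTop

/-! ## §3 `d = 3`: ROW S3-Lt — the top Λ increment is a local stencil family with an `n`-FREE constant -/

section Row

variable {Lc : ℕ} [NeZero Lc]

/-- [folklore] The radius `R″ = 2(d+1)(Lc+1)` of leaf-11's support lemma at `d = 3` (a natural number). Plumbing. -/
def rowR (Lc : ℕ) : ℕ := 2 * (3 + 1) * (Lc + 1)

/-- [folklore] The block-index radius `K = R″ + (d+1)` of the lattice-point support at `d = 3`. Plumbing. -/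
def rowK (Lc : ℕ) : ℕ := rowR Lc + (3 + 1)

/-- [folklore] The `n`-free mass constant `Cm = (4R″+1)⁴·(d+1)²·(2K+1)⁴·2ℓ²` at `d = 3`. Plumbing. -/
def rowCm (Lc : ℕ) : ℝ :=
  ((4 * rowR Lc + 1 : ℕ) : ℝ) ^ (3 + 1) * ((((3 : ℕ) : ℝ) + 1) * ((((3 : ℕ) : ℝ) + 1) * (((2 * rowK Lc + 1 : ℕ) : ℝ) ^ (3 + 1) *
    (2 * (ell (3 + 1) Lc : ℝ) ^ 2))))

/-- [folklore] The `n`-free support exponential `E = e^{κ((d+1)·2R″ + (d+1))}·e^{κ(((d+1)K + (d+1)) + (d+1))}` at `d = 3`. Plumbing. -/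
def rowE (Lc : ℕ) (κ : ℝ) : ℝ :=
  Real.exp (κ * ((((3 : ℕ) : ℝ) + 1) * (2 * (rowR Lc : ℝ)) + (((3 : ℕ) : ℝ) + 1))) *
    Real.exp (κ * (((((3 : ℕ) : ℝ) + 1) * (rowK Lc : ℝ) + (((3 : ℕ) : ℝ) + 1)) + (((3 : ℕ) : ℝ) + 1)))

omit [NeZero Lc] in
/-- [folklore] `rowCm` is nonnegative. -/
theorem rowCm_nonneg : 0 ≤ rowCm Lc := by unfold rowCm; positivity

/-- [folklore] THE SCALAR REARRANGEMENT of the final bound (pure commutative algebra, all atoms abstract):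
prefactor × `sandwich_bound`'s constant, with the geometric ratio `≤ 1` and the support exponentials `≤ E`. -/
theorem scalar_le {P NM d1 C₁ C₂ N3i Cm M4i e E Z X : ℝ} (hP : 0 ≤ P) (hd : 0 ≤ d1) (hC₁ : 0 ≤ C₁) (hC₂ : 0 ≤ C₂) (hCm : 0 ≤ Cm)
    (hZ : 0 ≤ Z) (hX : 0 ≤ X) (he : 0 ≤ e) (hE : e ≤ E) (hratio : NM * (N3i * M4i) ≤ 1) :
    P * NM * (d1 * (C₁ * C₁ * (C₂ * N3i) * (Cm * M4i) * e) * Z * X) ≤ P * (d1 * (C₁ * C₁ * C₂ * Cm * E) * Z) * X := by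
  have h0 : 0 ≤ P * d1 * C₁ * C₁ * C₂ * Cm * Z * X := by positivity
  calc P * NM * (d1 * (C₁ * C₁ * (C₂ * N3i) * (Cm * M4i) * e) * Z * X)
      = (P * d1 * C₁ * C₁ * C₂ * Cm * Z * X) * (NM * (N3i * M4i)) * e := by ring
    _ ≤ (P * d1 * C₁ * C₁ * C₂ * Cm * Z * X) * 1 * E :=
        mul_le_mul (mul_le_mul_of_nonneg_left hratio h0) hE he (by positivity)
    _ = P * (d1 * (C₁ * C₁ * C₂ * Cm * E) * Z) * X := by ring

/-- [folklore] THE GEOMETRIC RATIO of the top Λ row: `N·M^6·(N^3)⁻¹·(M^4)⁻¹ = (M∕N)² = Lc⁻² ≤ 1` (`N = M·Lc`, `Lc ≥ 1`). -/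
theorem ratio_le_one (hLc : 1 ≤ Lc) (n : ℕ) :
    (Lc : ℝ) ^ (n + 1 + 1) * ((Lc : ℝ) ^ (n + 1)) ^ (3 + 3) * ((((Lc : ℝ) ^ (n + 1 + 1)) ^ 3)⁻¹ * (((Lc : ℝ) ^ (n + 1)) ^ (3 + 1))⁻¹) ≤ 1 := by
  have hLc0 : (0 : ℝ) < Lc := by exact_mod_cast Nat.pos_of_ne_zero (NeZero.ne Lc)
  have hLc1 : (1 : ℝ) ≤ Lc := by exact_mod_cast hLc
  have hM0 : (0 : ℝ) < (Lc : ℝ) ^ (n + 1) := pow_pos hLc0 _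
  have heq : (Lc : ℝ) ^ (n + 1 + 1) * ((Lc : ℝ) ^ (n + 1)) ^ (3 + 3) *
      ((((Lc : ℝ) ^ (n + 1 + 1)) ^ 3)⁻¹ * (((Lc : ℝ) ^ (n + 1)) ^ (3 + 1))⁻¹) = ((Lc : ℝ) ^ 2)⁻¹ := by
    rw [pow_succ (Lc : ℝ) (n + 1)]
    field_simp
    ring
  rw [heq]
  exact inv_le_one_of_one_le₀ (one_le_pow₀ hLc1)

/-- [folklore] THE SUPPORT EXPONENTIALS of `sandwich_bound` with the row's radii are bounded by the `n`-free `rowE`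
(`R_W∕N = (d+1)·2R″∕Lc ≤ (d+1)·2R″`, `R_U∕N = (d+1)K + (d+1)` exactly). -/
theorem exp_supports_le {κ : ℝ} (hκ : 0 ≤ κ) (hLc : 1 ≤ Lc) (n : ℕ) :
    Real.exp (κ * ((((3 : ℕ) : ℝ) + 1) * ((2 * rowR Lc * Lc ^ (n + 1) : ℕ) : ℝ) / (Lc : ℝ) ^ (n + 1 + 1) + (((3 : ℕ) : ℝ) + 1))) *
      Real.exp (κ * ((Lc : ℝ) ^ (n + 1 + 1) * ((((3 : ℕ) : ℝ) + 1) * (rowK Lc : ℝ) + (((3 : ℕ) : ℝ) + 1)) / (Lc : ℝ) ^ (n + 1 + 1) +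
        (((3 : ℕ) : ℝ) + 1))) ≤ rowE Lc κ := by
  have hLc0 : (0 : ℝ) < Lc := by exact_mod_cast Nat.pos_of_ne_zero (NeZero.ne Lc)
  have hLc1 : (1 : ℝ) ≤ Lc := by exact_mod_cast hLc
  have hN0 : (0 : ℝ) < (Lc : ℝ) ^ (n + 1 + 1) := pow_pos hLc0 _
  have hM0 : (0 : ℝ) < (Lc : ℝ) ^ (n + 1) := pow_pos hLc0 _
  unfold rowE
  refine mul_le_mul ?_ (le_of_eq ?_) (Real.exp_pos _).le (Real.exp_pos _).le
  · rw [Real.exp_le_exp]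
    refine mul_le_mul_of_nonneg_left ?_ hκ
    have h1 : (((3 : ℕ) : ℝ) + 1) * ((2 * rowR Lc * Lc ^ (n + 1) : ℕ) : ℝ) / (Lc : ℝ) ^ (n + 1 + 1) ≤
        (((3 : ℕ) : ℝ) + 1) * (2 * (rowR Lc : ℝ)) := by
      rw [div_le_iff₀ hN0, pow_succ (Lc : ℝ) (n + 1)]
      push_cast
      have hR0 : (0 : ℝ) ≤ rowR Lc := Nat.cast_nonneg _
      nlinarith [mul_nonneg hM0.le hR0, mul_le_mul_of_nonneg_left hLc1 (mul_nonneg hM0.le hR0)]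
    linarith
  · rw [mul_div_cancel_left₀ _ hN0.ne']

/-- [folklore] **THE SANDWICH STEP** (member `n`, channel `(α, β)`): the owner's `TaylorSandwich.sandwich_bound` VERBATIM with the synthetic table `tabT`, its
supports `suppW`∕`suppU`, its per-`y` mass `rowCm·M^{−4}`, and legs at a common rate `κ` with constants `C₁` (outer) and `CH` (vertex). -/
theorem sandwich_le (hLc : 1 ≤ Lc) {κ C₁ CH : ℝ} (hκ : 0 < κ) (n : ℕ) (κ' α β : Fin (3 + 1)) (u' x' z' : Site (3 + 1))
    (hA : ∀ (l : Fin (3 + 1)) (w : Site (3 + 1)),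
      |((Lc : ℝ) ^ (n + 1 + 1)) ^ (3 + 2) * GamΦ (N := Lc ^ (n + 1 + 1)) α x' l w| ≤ C₁ * Real.exp (-κ * l1 (x' - quo (Lc ^ (n + 1 + 1)) w)))
    (hB : ∀ (l' : Fin (3 + 1)) (y : Site (3 + 1)),
      |((Lc : ℝ) ^ (n + 1 + 1)) ^ (3 + 2) * wH (N := Lc ^ (n + 1 + 1)) l' β (y - ((Lc ^ (n + 1 + 1) : ℕ) : ℤ) • z')| ≤
        C₁ * Real.exp (-κ * l1 (quo (Lc ^ (n + 1 + 1)) y - z')))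
    (hH : ∀ (μ : Fin (3 + 1)) (u : Site (3 + 1)),
      |((Lc : ℝ) ^ (n + 1 + 1)) ^ (3 + 2) * wΦ (N := Lc ^ (n + 1 + 1)) κ' μ (u' - quo (Lc ^ (n + 1 + 1)) u)| ≤
        CH * Real.exp (-κ * l1 (quo (Lc ^ (n + 1 + 1)) u - u'))) :
    |∑' y : Site (3 + 1), ∑ l' : Fin (3 + 1),
        (∑' w : Site (3 + 1), ∑ l : Fin (3 + 1), ((Lc : ℝ) ^ (n + 1 + 1)) ^ (3 + 2) * GamΦ (N := Lc ^ (n + 1 + 1)) α x' l w *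
            ∑ μ : Fin (3 + 1), (((Lc : ℝ) ^ (n + 1 + 1)) ^ (3 + 1))⁻¹ *
              ∑' u : Site (3 + 1), ((Lc : ℝ) ^ (n + 1 + 1)) ^ (3 + 2) * wΦ (N := Lc ^ (n + 1 + 1)) κ' μ (u' - quo (Lc ^ (n + 1 + 1)) u) *
                tabT (d := 3) Lc (Lc ^ (n + 1)) (Lc ^ (n + 1 + 1)) μ u w l y l') *
          (((Lc : ℝ) ^ (n + 1 + 1)) ^ (3 + 2) * wH (N := Lc ^ (n + 1 + 1)) l' β (y - ((Lc ^ (n + 1 + 1) : ℕ) : ℤ) • z'))| ≤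
      (((3 : ℕ) : ℝ) + 1) * (C₁ * C₁ * CH * (rowCm Lc * (((Lc : ℝ) ^ (n + 1)) ^ (3 + 1))⁻¹) *
        (Real.exp (κ * ((((3 : ℕ) : ℝ) + 1) * ((2 * rowR Lc * Lc ^ (n + 1) : ℕ) : ℝ) / (Lc : ℝ) ^ (n + 1 + 1) + (((3 : ℕ) : ℝ) + 1))) *
          Real.exp (κ * ((Lc : ℝ) ^ (n + 1 + 1) * ((((3 : ℕ) : ℝ) + 1) * (rowK Lc : ℝ) + (((3 : ℕ) : ℝ) + 1)) / (Lc : ℝ) ^ (n + 1 + 1) +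
            (((3 : ℕ) : ℝ) + 1))))) *
        Zl (3 + 1) (κ / 2) * Real.exp (-(κ / 2) * (l1 (x' - u') + l1 (z' - u'))) := by
  have hLc0 : (0 : ℝ) < Lc := by exact_mod_cast Nat.pos_of_ne_zero (NeZero.ne Lc)
  have hNML : Lc ^ (n + 1 + 1) = Lc ^ (n + 1) * Lc := pow_succ Lc (n + 1)
  have hM0 : (0 : ℝ) < (Lc : ℝ) ^ (n + 1) := pow_pos hLc0 _
  have hM1 : (1 : ℝ) ≤ (Lc : ℝ) ^ (n + 1) := one_le_pow₀ (by exact_mod_cast hLc)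
  have hcastN : ((Lc ^ (n + 1 + 1) : ℕ) : ℝ) = (Lc : ℝ) ^ (n + 1 + 1) := by push_cast; rfl
  have hcastM : ((Lc ^ (n + 1) : ℕ) : ℝ) = (Lc : ℝ) ^ (n + 1) := by push_cast; rfl
  -- supports, radii and mass of the synthetic table
  have hK : 2 * (((3 : ℕ) : ℝ) + 1) * (Lc + 1) + (((3 : ℕ) : ℝ) + 1) ≤ (rowK Lc : ℝ) := by
    unfold rowK rowR; push_cast; nlinarith
  have hK₂ : 4 * (((3 : ℕ) : ℝ) + 1) * (Lc + 1) * ((Lc ^ (n + 1) : ℕ) : ℝ) ≤ ((2 * rowR Lc * Lc ^ (n + 1) : ℕ) : ℝ) := by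
    unfold rowR; push_cast; nlinarith [hM0]
  have hTw : ∀ (κ'' : Fin (3 + 1)) (u w : Site (3 + 1)) (l : Fin (3 + 1)) (y : Site (3 + 1)) (l' : Fin (3 + 1)),
      tabT (d := 3) Lc (Lc ^ (n + 1)) (Lc ^ (n + 1 + 1)) κ'' u w l y l' ≠ 0 → w ∈ suppW 3 (2 * rowR Lc * Lc ^ (n + 1)) y :=
    fun κ'' u w l y l' h => mem_suppW_of_ne_zero hLc hNML hK₂ h
  have hTu : ∀ (κ'' : Fin (3 + 1)) (u w : Site (3 + 1)) (l : Fin (3 + 1)) (y : Site (3 + 1)) (l' : Fin (3 + 1)),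
      tabT (d := 3) Lc (Lc ^ (n + 1)) (Lc ^ (n + 1 + 1)) κ'' u w l y l' ≠ 0 → u ∈ suppU 3 (Lc ^ (n + 1 + 1)) (rowK Lc) y :=
    fun κ'' u w l y l' h => mem_suppU_of_ne_zero hLc hNML hK h
  have hRw : ∀ y : Site (3 + 1), ∀ w ∈ suppW 3 (2 * rowR Lc * Lc ^ (n + 1)) y,
      l1 (w - y) ≤ (((3 : ℕ) : ℝ) + 1) * ((2 * rowR Lc * Lc ^ (n + 1) : ℕ) : ℝ) := fun y w hw => l1_sub_le_of_mem_suppW hw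
  have hRu : ∀ y : Site (3 + 1), ∀ u ∈ suppU 3 (Lc ^ (n + 1 + 1)) (rowK Lc) y,
      l1 (u - y) ≤ ((Lc ^ (n + 1 + 1) : ℕ) : ℝ) * ((((3 : ℕ) : ℝ) + 1) * (rowK Lc : ℝ) + (((3 : ℕ) : ℝ) + 1)) :=
    fun y u hu => l1_sub_le_of_mem_suppU hu
  have hmass : ∀ (y : Site (3 + 1)) (l' : Fin (3 + 1)),
      ∑ w ∈ suppW 3 (2 * rowR Lc * Lc ^ (n + 1)) y, ∑ l : Fin (3 + 1), ∑ μ : Fin (3 + 1), ∑ u ∈ suppU 3 (Lc ^ (n + 1 + 1)) (rowK Lc) y,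
        |tabT (d := 3) Lc (Lc ^ (n + 1)) (Lc ^ (n + 1 + 1)) μ u w l y l'| ≤ rowCm Lc * (((Lc : ℝ) ^ (n + 1)) ^ (3 + 1))⁻¹ := by
    intro y l'
    refine (mass_tabT_le (N := Lc ^ (n + 1 + 1)) hLc (rowK Lc) (2 * rowR Lc * Lc ^ (n + 1)) y l').trans ?_
    rw [hcastM]
    have h1 : ((2 * (2 * rowR Lc * Lc ^ (n + 1)) + 1 : ℕ) : ℝ) ≤ ((4 * rowR Lc + 1 : ℕ) : ℝ) * (Lc : ℝ) ^ (n + 1) := by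
      push_cast; nlinarith [hM1]
    have h2 : ((2 * (2 * rowR Lc * Lc ^ (n + 1)) + 1 : ℕ) : ℝ) ^ (3 + 1) ≤ ((4 * rowR Lc + 1 : ℕ) : ℝ) ^ (3 + 1) * ((Lc : ℝ) ^ (n + 1)) ^ (3 + 1) := by
      rw [← mul_pow]; exact pow_le_pow_left₀ (by positivity) h1 _
    have h3 : ((4 * rowR Lc + 1 : ℕ) : ℝ) ^ (3 + 1) * ((Lc : ℝ) ^ (n + 1)) ^ (3 + 1) *
        ((((3 : ℕ) : ℝ) + 1) * ((((3 : ℕ) : ℝ) + 1) * (((2 * rowK Lc + 1 : ℕ) : ℝ) ^ (3 + 1) *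
          (2 * (ell (3 + 1) Lc : ℝ) ^ 2 / ((Lc : ℝ) ^ (n + 1)) ^ (2 * (3 + 1)))))) = rowCm Lc * (((Lc : ℝ) ^ (n + 1)) ^ (3 + 1))⁻¹ := by
      unfold rowCm; field_simp; ring
    rw [← h3]
    exact mul_le_mul_of_nonneg_right h2 (by positivity)
  have hsb := sandwich_bound (N := Lc ^ (n + 1 + 1)) (d := 3) (x' := x') (u' := u') (z' := z')
    (A := fun l w => ((Lc : ℝ) ^ (n + 1 + 1)) ^ (3 + 2) * GamΦ (N := Lc ^ (n + 1 + 1)) α x' l w)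
    (B := fun l' y => ((Lc : ℝ) ^ (n + 1 + 1)) ^ (3 + 2) * wH (N := Lc ^ (n + 1 + 1)) l' β (y - ((Lc ^ (n + 1 + 1) : ℕ) : ℤ) • z'))
    (H := fun μ u => ((Lc : ℝ) ^ (n + 1 + 1)) ^ (3 + 2) * wΦ (N := Lc ^ (n + 1 + 1)) κ' μ (u' - quo (Lc ^ (n + 1 + 1)) u))
    (T := tabT (d := 3) Lc (Lc ^ (n + 1)) (Lc ^ (n + 1 + 1)))
    hκ hA hB hH hTw hTu hRw hRu hmass
  rw [hcastN] at hsb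
  exact hsb

/-- [folklore] **ROW S3-Lt FROM THE LEGS** (the `_of_legs` form the owner asked to keep, l.5008): the vertex∕right and left (N1) legs in
`StencilSlotE3HLeg.legs_three`'s literal shapes and the K-slot leg in `StencilSlotE3PhiLeg.phiLeg_three`'s first shape ⟹ `∃ CtL δ, 0 < δ ∧ hLt` (d = 3, every `Lc ≥ 1`).
`δ = min(κ₁, δ₂)∕2`; `CtL = (|cΛ|∕Lc⁴)·((d+1)·C₁²·C₂·rowCm·rowE·Zl₄(δ))` — FREE OF `n`. -/
theorem rowLamTop_of_legs (hLc : 1 ≤ Lc) (cΛ : ℝ) {C₁ κ₁ C₂ δ₂ : ℝ} (hκ₁ : 0 < κ₁) (hC₁ : 0 ≤ C₁) (hδ₂ : 0 < δ₂) (hC₂ : 0 ≤ C₂)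
    (hV : ∀ (j : ℕ) (k l : Fin (3 + 1)) (u u' : Fin (3 + 1) → ℤ),
      |((Lc : ℝ) ^ (j + 1)) ^ (3 + 2) * wH (N := Lc ^ (j + 1)) k l (u - (((Lc ^ (j + 1) : ℕ) : ℤ)) • u')| ≤
        C₁ * Real.exp (-κ₁ * l1 (quo (Lc ^ (j + 1)) u - u')))
    (hG : ∀ (j : ℕ) (α l : Fin (3 + 1)) (x' w : Fin (3 + 1) → ℤ),
      |((Lc : ℝ) ^ (j + 1)) ^ (3 + 2) * GamΦ (N := Lc ^ (j + 1)) α x' l w| ≤ C₁ * Real.exp (-κ₁ * l1 (x' - quo (Lc ^ (j + 1)) w)))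
    (hΦ : ∀ (j : ℕ) (x' w : Fin (3 + 1) → ℤ) (α β : Fin (3 + 1)),
      |((Lc : ℝ) ^ (j + 1)) ^ (2 * (3 + 1)) * KInv (N := Lc ^ (j + 1)) (d := 3) (((Lc ^ (j + 1) : ℕ) : ℤ) • x') w (Sum.inr α) (Sum.inr β)| ≤
        C₂ * Real.exp (-δ₂ * l1 (x' - quo (Lc ^ (j + 1)) w))) :
    ∃ CtL δ : ℝ, 0 < δ ∧ ∀ n : ℕ, LocStencil (fun κ' u' x' z' a b => ((Lc : ℝ) ^ (n + 1 + 1)) ^ (2 * (3 + 1)) *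
      e3OfS (Lc ^ (n + 1 + 1)) (fun κ u => (cΛ * ((Lc : ℝ) ^ (n + 1)) ^ (2 * 3 + 4)) •
        lagrInc 3 Lc (Lc ^ (n + 1)) (Lc ^ (n + 1 + 1)) κ u) κ' u' x' z' a b) CtL δ := by
  set κ : ℝ := min κ₁ δ₂ with hκdef
  have hκ : 0 < κ := lt_min hκ₁ hδ₂
  have hκ₁' : κ ≤ κ₁ := min_le_left _ _
  have hκ₂' : κ ≤ δ₂ := min_le_right _ _
  have hLc0 : (0 : ℝ) < Lc := by exact_mod_cast Nat.pos_of_ne_zero (NeZero.ne Lc)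
  have hZ : 0 < Zl (3 + 1) (κ / 2) := Zl_pos (half_pos hκ)
  have hCm := rowCm_nonneg (Lc := Lc)
  refine ⟨|cΛ| / (Lc : ℝ) ^ (3 + 1) * ((((3 : ℕ) : ℝ) + 1) * (C₁ * C₁ * C₂ * rowCm Lc * rowE Lc κ) * Zl (3 + 1) (κ / 2)), κ / 2, half_pos hκ,
    fun n => ?_⟩
  intro κ' u' x' z' a b
  dsimp only
  have hpos : 0 ≤ |cΛ| / (Lc : ℝ) ^ (3 + 1) * ((((3 : ℕ) : ℝ) + 1) * (C₁ * C₁ * C₂ * rowCm Lc * rowE Lc κ) * Zl (3 + 1) (κ / 2)) *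
      Real.exp (-(κ / 2) * (l1 (x' - u') + l1 (z' - u'))) := by
    have : 0 ≤ rowE Lc κ := by unfold rowE; positivity
    positivity
  rcases a with α | ν
  swap
  · rw [e3OfS_inr, mul_zero, abs_zero]; exact hpos
  rcases b with β | ν'
  swap
  · rw [e3OfS_inl_inr, mul_zero, abs_zero]; exact hpos
  -- the main case: member `n`, `N = Lc^(n+2)`, `M = Lc^(n+1)`
  have hN0 : (0 : ℝ) < (Lc : ℝ) ^ (n + 1 + 1) := pow_pos hLc0 _
  have hM0 : (0 : ℝ) < (Lc : ℝ) ^ (n + 1) := pow_pos hLc0 _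
  -- (1) unit split and the Λ vertex in sandwich shape
  rw [e3LamTop_unit_split (Lc := Lc) (d := 3) cΛ (n + 1) (n + 1 + 1) rfl κ' u' x' z' α β]
  simp only [vertex_sandwich_form (d := 3) (Lc := Lc) (M := Lc ^ (n + 1)) (N := Lc ^ (n + 1 + 1)) hLc]
  -- (2) the legs at the common rate
  have hA : ∀ (l : Fin (3 + 1)) (w : Site (3 + 1)),
      |((Lc : ℝ) ^ (n + 1 + 1)) ^ (3 + 2) * GamΦ (N := Lc ^ (n + 1 + 1)) α x' l w| ≤
        C₁ * Real.exp (-κ * l1 (x' - quo (Lc ^ (n + 1 + 1)) w)) := fun l w =>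
    bound_mono (hG (n + 1) α l x' w) hC₁ le_rfl hκ₁' (l1_nonneg _)
  have hB : ∀ (l' : Fin (3 + 1)) (y : Site (3 + 1)),
      |((Lc : ℝ) ^ (n + 1 + 1)) ^ (3 + 2) * wH (N := Lc ^ (n + 1 + 1)) l' β (y - ((Lc ^ (n + 1 + 1) : ℕ) : ℤ) • z')| ≤
        C₁ * Real.exp (-κ * l1 (quo (Lc ^ (n + 1 + 1)) y - z')) := fun l' y =>
    bound_mono (hV (n + 1) l' β y z') hC₁ le_rfl hκ₁' (l1_nonneg _)
  have hH : ∀ (μ : Fin (3 + 1)) (u : Site (3 + 1)),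
      |((Lc : ℝ) ^ (n + 1 + 1)) ^ (3 + 2) * wΦ (N := Lc ^ (n + 1 + 1)) κ' μ (u' - quo (Lc ^ (n + 1 + 1)) u)| ≤
        C₂ * (((Lc : ℝ) ^ (n + 1 + 1)) ^ 3)⁻¹ * Real.exp (-κ * l1 (quo (Lc ^ (n + 1 + 1)) u - u')) := by
    intro μ u
    have h := hΦ (n + 1) u' (((Lc ^ (n + 1 + 1) : ℕ) : ℤ) • quo (Lc ^ (n + 1 + 1)) u) κ' μ
    rw [KInv_inr_inr_coarse, quo_zsmul, l1_sub_symm] at h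
    have hsplit : ((Lc : ℝ) ^ (n + 1 + 1)) ^ (3 + 2) * wΦ (N := Lc ^ (n + 1 + 1)) κ' μ (u' - quo (Lc ^ (n + 1 + 1)) u) =
        (((Lc : ℝ) ^ (n + 1 + 1)) ^ 3)⁻¹ * (((Lc : ℝ) ^ (n + 1 + 1)) ^ (2 * (3 + 1)) *
          wΦ (N := Lc ^ (n + 1 + 1)) κ' μ (u' - quo (Lc ^ (n + 1 + 1)) u)) := by
      field_simp
      ring
    rw [hsplit, abs_mul, abs_of_pos (inv_pos.2 (pow_pos hN0 3)), mul_comm C₂, mul_assoc]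
    refine mul_le_mul_of_nonneg_left ?_ (inv_pos.2 (pow_pos hN0 3)).le
    exact bound_mono h hC₂ le_rfl hκ₂' (l1_nonneg _)
  -- (3)+(4) the sandwich step
  have hsb := sandwich_le hLc hκ n κ' α β u' x' z' hA hB hH
  -- (5) prefactor arithmetic
  have hz : ((Lc : ℝ) ^ (n + 1 + 1)) ^ (((3 : ℕ) : ℤ) - 2) = (Lc : ℝ) ^ (n + 1 + 1) := by norm_num
  rw [hz, abs_mul]
  have hpref : |-(cΛ / (Lc : ℝ) ^ (3 + 1)) * (Lc : ℝ) ^ (n + 1 + 1) * ((Lc : ℝ) ^ (n + 1)) ^ (3 + 3)| =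
      |cΛ| / (Lc : ℝ) ^ (3 + 1) * ((Lc : ℝ) ^ (n + 1 + 1) * ((Lc : ℝ) ^ (n + 1)) ^ (3 + 3)) := by
    rw [abs_mul, abs_mul, abs_neg, abs_div, abs_of_pos (pow_pos hLc0 _), abs_of_pos hN0, abs_of_pos (pow_pos hM0 _), mul_assoc]
  rw [hpref]
  refine (mul_le_mul_of_nonneg_left hsb (by positivity)).trans ?_
  exact scalar_le (by positivity) (by positivity) hC₁ hC₂ hCm hZ.le (Real.exp_pos _).le (by positivity)
    (exp_supports_le hκ.le hLc n) (ratio_le_one hLc n)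


/-- [folklore] **ROW S3-Lt (ROW-Λt) AT `d = 3`, HYPOTHESES-FREE**: for every `Lc ≥ 1` and every real weight `cΛ` there are `CtL` and `δ > 0` such that for EVERY member
`n` the unit-rescaled third-jet functional of the top Λ increment `(cΛ·M^{2·3+4}) • lagrInc 3 Lc M N` (`N = Lc^{n+2}`, `M = Lc^{n+1}`) is a `LocStencil … CtL δ` — the
hypothesis `hLt` of `StencilSlotE3OfPieces.e3Shape_of_pieces` (staged 2cc3c5eb8d83de1a, filed p206785) with `d := 3` substituted textually, ∃-packaged at the row's own rate
(carver l.4876 (3), ref2 (h)(k)(l)); legs discharged inside by `StencilSlotE3HLeg.legs_three` ((N1), leaf-16's `FineReadoutDecay`) and `StencilSlotE3PhiLeg.phiLeg_three`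
(road P1's K-slot). -/
theorem rowLamTop (hLc : 1 ≤ Lc) (cΛ : ℝ) :
    ∃ CtL δ : ℝ, 0 < δ ∧ ∀ n : ℕ, LocStencil (fun κ' u' x' z' a b => ((Lc : ℝ) ^ (n + 1 + 1)) ^ (2 * (3 + 1)) *
      e3OfS (Lc ^ (n + 1 + 1)) (fun κ u => (cΛ * ((Lc : ℝ) ^ (n + 1)) ^ (2 * 3 + 4)) •
        lagrInc 3 Lc (Lc ^ (n + 1)) (Lc ^ (n + 1 + 1)) κ u) κ' u' x' z' a b) CtL δ := by
  obtain ⟨C₁, κ₁, hκ₁, hC₁, hV, hG⟩ := legs_three (Lc := Lc)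
  obtain ⟨C₂, δ₂, hδ₂, hC₂, hΦ, -⟩ := phiLeg_three (Lc := Lc)
  exact rowLamTop_of_legs hLc cΛ hκ₁ hC₁ hδ₂ hC₂ hV hG hΦ

end Row

end Summit.QuantumFields.BalabanUV.Beta.GAN24.TaylorRowLamTop

end
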